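import Summits.CriticalPhenomena.PercolationContinuityZ3.Theorems.PercNearOneGluingNoHeavyQuantTwoBigChain
import HarnessLib

/-!
# QUANT lane R8, Conjecture DIB\* — the two-big certificate, cell `HL/C2, block B2lo`

builds on p205010 (kernel theorem, internal audit signed; external expert review pending)

Support file (`--supports stmt-CriticalPhenomena-4575`), QUANT lane census-1 (gen 17); memo
`run/shared/lean/prim/quant/prim-quant-census-1/TWOBIG-G17.md`.  Theorems only, no definitions, no sorries, standard axioms.
Coordinates `y = 1 − x`, `uᵢ = αᵢφᵢ`, `vᵢ = αᵢ(1 − φᵢ)` (`αᵢ = bᵢ/j`, `φᵢ` = credit rate of big `i`); the three `tbcBlock_*` lemmas are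
LP-found Handelman certificates (products of the cell's defining inequalities, replayed by `linarith`) of a separable budget split
`c₁ + c₂ + c₀ = (1−y)α₁α₂ − P₁P₂`, `cₖ·Dₖ ≤ Bₖ·Nₖ`; `tbcCell_*` combines them into the reduced inequality of the cell
(items in product form).  [this work]; the gluing rows served [cite: KozmaNitzan2024, Conjecture 3 (p. 15)].
-/

namespace Summit.CriticalPhenomena.PercolationContinuityZ3.Theorems

namespace Quant

namespace IndepBlob

set_option maxHeartbeats 1000000 in
set_option maxRecDepth 8192 in
/-- Two-big cell `RL/C2`, block 2: Handelman support (217 products; kit LP; split polynomial rounded to denominators ≤ 256). [this work] -/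
theorem tbcBlock_HL_C2_lo_2 (y u₁ r₁ u₂ v₂ : ℝ) (_hy : 0 ≤ y) (_hhy : 0 ≤ 1 / 2 - y) (_hu1 : 0 ≤ u₁) (_hv1 : 0 ≤ r₁) (_hu2 : 0 ≤ u₂)
    (_hv2 : 0 ≤ v₂) (_ha1 : 0 ≤ 1 - u₁ - y * r₁) (_hb1 : 0 ≤ u₁ + y * r₁ - 1 / 2) (_ha2 : 0 ≤ 1 - u₂ - v₂) (_hb2 : 0 ≤ u₂ + v₂ - 1 / 2)
    (_ht1 : 0 ≤ u₁ - (1 - y) * r₁) (_ht2 : 0 ≤ (1 - y) * v₂ - u₂ * y) (_hc1 : 0 ≤ 1 - (2 - u₁ - u₂))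
    (_hr1 : 0 ≤ (2 - u₁ - u₂) - (2 - y) * (1 - u₁ - y * r₁)) (_hr2 : 0 ≤ (2 - u₁ - u₂) - (2 - y) * (1 - u₂ - v₂)) (_hsub : 0 ≤ 1 / 4 - y) :
    (13 / 256 - 47 / 256 * y - 13 / 128 * u₁ - 3 / 128 * r₁ - 25 / 256 * u₂ - 35 / 256 * v₂ + 3 / 256 * y ^ 2 + 23 / 32 * y * u₁ - 5 / 64 * y * r₁ +
          87 / 256 * y * u₂ + 63 / 256 * y * v₂ - 15 / 128 * u₁ ^ 2 - 5 / 64 * u₁ * r₁ - 19 / 128 * u₁ * u₂ + 7 / 64 * u₁ * v₂ + 239 / 256 * r₁ * u₂ +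
          245 / 256 * r₁ * v₂ + 5 / 64 * u₂ ^ 2 + 51 / 256 * u₂ * v₂ + 1 / 256 * v₂ ^ 2 + 79 / 256 * y ^ 2 * r₁ - 3 / 256 * y ^ 2 * u₂ - 3 / 256 * y ^
          2 * v₂ - 15 / 128 * y * u₁ * r₁ - 93 / 128 * y * u₁ * u₂ - 93 / 128 * y * u₁ * v₂ - 7 / 256 * y * r₁ ^ 2 - 135 / 128 * y * r₁ * u₂ - 291 /
          256 * y * r₁ * v₂ - 21 / 128 * y * u₂ ^ 2 - 47 / 256 * y * u₂ * v₂ - 1 / 128 * y * v₂ ^ 2 - 1 / 256 * u₁ * r₁ * u₂ - 1 / 256 * u₁ * r₁ * v₂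
          + 1 / 256 * u₁ * u₂ ^ 2 + 3 / 256 * u₁ * u₂ * v₂ + 1 / 256 * u₁ * v₂ ^ 2 + 1 / 256 * r₁ * u₂ ^ 2 + 1 / 128 * r₁ * u₂ * v₂ + 1 / 256 * r₁ *
          v₂ ^ 2 + 1 / 256 * u₂ ^ 2 * v₂ + 1 / 256 * u₂ * v₂ ^ 2) * (y * (2 - u₁ - u₂) + (1 + v₂ - u₁) ^ 2)
      ≤ (r₁ * ((u₂ + v₂) * (1 - y) ^ 2 + y * u₂)) * (1 + v₂ - u₁) ^ 2 := by
  linarith [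
    mul_nonneg (mul_nonneg (mul_nonneg (mul_nonneg (mul_nonneg _hy _hy) _hy) _hhy) _hv1) _hv1,
    mul_nonneg (mul_nonneg (mul_nonneg (mul_nonneg (mul_nonneg _hy _hy) _hy) _hv1) _hv1) _hv2,
    mul_nonneg (mul_nonneg (mul_nonneg (mul_nonneg (mul_nonneg _hy _hy) _hy) _hv1) _hv1) _hb2,
    mul_nonneg (mul_nonneg (mul_nonneg (mul_nonneg (mul_nonneg _hy _hy) _hy) _hv1) _hv1) _hsub,
    mul_nonneg (mul_nonneg (mul_nonneg (mul_nonneg (mul_nonneg _hy _hy) _hy) _hv1) _hu2) _hv2,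
    mul_nonneg (mul_nonneg (mul_nonneg (mul_nonneg (mul_nonneg _hy _hy) _hy) _hv1) _hv2) _hb2,
    mul_nonneg (mul_nonneg (mul_nonneg (mul_nonneg (mul_nonneg _hy _hy) _hy) _hv1) _hb2) _hb2,
    mul_nonneg (mul_nonneg (mul_nonneg (mul_nonneg _hy _hy) _hy) _hu2) _ha2, mul_nonneg (mul_nonneg (mul_nonneg _hy _hy) _hy) _ha1,
    mul_nonneg (mul_nonneg (mul_nonneg (mul_nonneg _hy _hy) _hhy) _hv1) _ht1,
    mul_nonneg (mul_nonneg (mul_nonneg (mul_nonneg (mul_nonneg _hy _hy) _hu1) _hu1) _hv1) _hv2,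
    mul_nonneg (mul_nonneg (mul_nonneg (mul_nonneg (mul_nonneg _hy _hy) _hu1) _hv1) _hv2) _hc1,
    mul_nonneg (mul_nonneg (mul_nonneg (mul_nonneg _hy _hy) _hu1) _hv1) _ha2,
    mul_nonneg (mul_nonneg (mul_nonneg (mul_nonneg _hy _hy) _hu1) _hv1) _ht1,
    mul_nonneg (mul_nonneg (mul_nonneg (mul_nonneg (mul_nonneg _hy _hy) _hu1) _hv2) _hv2) _hb2,
    mul_nonneg (mul_nonneg (mul_nonneg (mul_nonneg _hy _hy) _hu1) _ha1) _hb2, mul_nonneg (mul_nonneg (mul_nonneg _hy _hy) _hu1) _hr2,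
    mul_nonneg (mul_nonneg (mul_nonneg (mul_nonneg (mul_nonneg _hy _hy) _hv1) _hv1) _ha2) _ha2,
    mul_nonneg (mul_nonneg (mul_nonneg (mul_nonneg _hy _hy) _hv1) _hu2) _hr2,
    mul_nonneg (mul_nonneg (mul_nonneg (mul_nonneg (mul_nonneg _hy _hy) _hv1) _hv2) _hb2) _hb2,
    mul_nonneg (mul_nonneg (mul_nonneg (mul_nonneg (mul_nonneg _hy _hy) _hv1) _ha2) _hb2) _hsub,
    mul_nonneg (mul_nonneg (mul_nonneg (mul_nonneg _hy _hy) _hv1) _ha2) _hc1,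
    mul_nonneg (mul_nonneg (mul_nonneg (mul_nonneg _hy _hy) _hv1) _hb2) _hr2, mul_nonneg (mul_nonneg (mul_nonneg _hy _hy) _hv1) _ht1,
    mul_nonneg (mul_nonneg (mul_nonneg _hy _hy) _hv1) _ht2, mul_nonneg (mul_nonneg (mul_nonneg _hy _hy) _hv1) _hr2,
    mul_nonneg (mul_nonneg (mul_nonneg (mul_nonneg _hy _hy) _hu2) _hv2) _hv2,
    mul_nonneg (mul_nonneg (mul_nonneg (mul_nonneg (mul_nonneg _hy _hy) _hv2) _hv2) _hb2) _hc1,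
    mul_nonneg (mul_nonneg (mul_nonneg (mul_nonneg (mul_nonneg _hy _hy) _hv2) _ha2) _hc1) _hc1,
    mul_nonneg (mul_nonneg (mul_nonneg (mul_nonneg _hy _hy) _ha1) _hb2) _hc1,
    mul_nonneg (mul_nonneg (mul_nonneg (mul_nonneg _hy _hy) _hb1) _ha2) _hc1,
    mul_nonneg (mul_nonneg (mul_nonneg (mul_nonneg _hy _hy) _ha2) _hc1) _hc1, mul_nonneg (mul_nonneg (mul_nonneg _hy _hy) _ht1) _hc1,
    mul_nonneg (mul_nonneg (mul_nonneg (mul_nonneg (mul_nonneg _hy _hhy) _hhy) _ha2) _ha2) _hc1,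
    mul_nonneg (mul_nonneg (mul_nonneg (mul_nonneg _hy _hhy) _hhy) _ha2) _ht1,
    mul_nonneg (mul_nonneg (mul_nonneg (mul_nonneg _hy _hhy) _hv1) _hv1) _ha1,
    mul_nonneg (mul_nonneg (mul_nonneg (mul_nonneg _hy _hhy) _hv1) _hv1) _ht2,
    mul_nonneg (mul_nonneg (mul_nonneg (mul_nonneg _hy _hhy) _hv1) _hv1) _hr2,
    mul_nonneg (mul_nonneg (mul_nonneg (mul_nonneg (mul_nonneg _hy _hhy) _hv1) _ha2) _ha2) _ha2,
    mul_nonneg (mul_nonneg (mul_nonneg (mul_nonneg _hy _hhy) _hv1) _ht2) _hc1, mul_nonneg (mul_nonneg (mul_nonneg _hy _hhy) _ha1) _ht1,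
    mul_nonneg (mul_nonneg (mul_nonneg (mul_nonneg (mul_nonneg _hy _hhy) _ha2) _ha2) _ha2) _hc1,
    mul_nonneg (mul_nonneg (mul_nonneg _hy _hhy) _ht1) _hr2, mul_nonneg (mul_nonneg (mul_nonneg (mul_nonneg _hy _hu1) _hu1) _hv2) _hr2,
    mul_nonneg (mul_nonneg (mul_nonneg (mul_nonneg _hy _hu1) _hu1) _ha1) _ha2,
    mul_nonneg (mul_nonneg (mul_nonneg (mul_nonneg _hy _hu1) _hv1) _hv2) _ht2,
    mul_nonneg (mul_nonneg (mul_nonneg (mul_nonneg _hy _hu1) _hv1) _hv2) _hr2,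
    mul_nonneg (mul_nonneg (mul_nonneg (mul_nonneg (mul_nonneg _hy _hu1) _hu2) _hu2) _hv2) _ha2,
    mul_nonneg (mul_nonneg (mul_nonneg (mul_nonneg (mul_nonneg _hy _hu1) _hv2) _hv2) _hv2) _hb2,
    mul_nonneg (mul_nonneg (mul_nonneg (mul_nonneg (mul_nonneg _hy _hu1) _hv2) _hv2) _ha2) _hc1,
    mul_nonneg (mul_nonneg (mul_nonneg (mul_nonneg _hy _hu1) _hv2) _hv2) _hr2,
    mul_nonneg (mul_nonneg (mul_nonneg (mul_nonneg _hy _hu1) _hv2) _ha2) _hc1,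
    mul_nonneg (mul_nonneg (mul_nonneg (mul_nonneg _hy _hu1) _hv2) _ht1) _hc1,
    mul_nonneg (mul_nonneg (mul_nonneg (mul_nonneg _hy _hu1) _ha1) _ha2) _hc1,
    mul_nonneg (mul_nonneg (mul_nonneg (mul_nonneg _hy _hu1) _ha1) _hb2) _hb2,
    mul_nonneg (mul_nonneg (mul_nonneg (mul_nonneg _hy _hu1) _ha2) _ht2) _hc1,
    mul_nonneg (mul_nonneg (mul_nonneg (mul_nonneg _hy _hu1) _hb2) _hc1) _hr2,
    mul_nonneg (mul_nonneg (mul_nonneg (mul_nonneg _hy _hv1) _hv1) _hb2) _hr2,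
    mul_nonneg (mul_nonneg (mul_nonneg (mul_nonneg _hy _hv1) _hv1) _hc1) _hr2,
    mul_nonneg (mul_nonneg (mul_nonneg (mul_nonneg _hy _hv1) _hu2) _ha1) _hc1,
    mul_nonneg (mul_nonneg (mul_nonneg (mul_nonneg (mul_nonneg _hy _hv1) _hv2) _ha2) _ha2) _hc1,
    mul_nonneg (mul_nonneg (mul_nonneg (mul_nonneg _hy _hv1) _hv2) _ha2) _ht1,
    mul_nonneg (mul_nonneg (mul_nonneg (mul_nonneg _hy _hv1) _hv2) _hc1) _hr2,
    mul_nonneg (mul_nonneg (mul_nonneg (mul_nonneg _hy _hv1) _ha1) _hb2) _hc1, mul_nonneg (mul_nonneg (mul_nonneg _hy _hv1) _ha1) _hc1,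
    mul_nonneg (mul_nonneg (mul_nonneg (mul_nonneg _hy _hv1) _ha2) _ha2) _ht1,
    mul_nonneg (mul_nonneg (mul_nonneg (mul_nonneg _hy _hv1) _hb2) _hc1) _hr2, mul_nonneg (mul_nonneg (mul_nonneg _hy _hv1) _ht2) _hc1,
    mul_nonneg (mul_nonneg (mul_nonneg (mul_nonneg _hy _hv1) _hsub) _hc1) _hr2,
    mul_nonneg (mul_nonneg (mul_nonneg (mul_nonneg _hy _hu2) _hu2) _hu2) _ha1,
    mul_nonneg (mul_nonneg (mul_nonneg (mul_nonneg _hy _hu2) _hu2) _hv2) _ht1,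
    mul_nonneg (mul_nonneg (mul_nonneg (mul_nonneg _hy _hu2) _hu2) _ha2) _ht1,
    mul_nonneg (mul_nonneg (mul_nonneg (mul_nonneg _hy _hu2) _hu2) _ha2) _hr2,
    mul_nonneg (mul_nonneg (mul_nonneg (mul_nonneg _hy _hu2) _hu2) _hb2) _ht2,
    mul_nonneg (mul_nonneg (mul_nonneg (mul_nonneg _hy _hu2) _ha2) _hb2) _hr2, mul_nonneg (mul_nonneg (mul_nonneg _hy _hu2) _ha2) _ht1,
    mul_nonneg (mul_nonneg (mul_nonneg _hy _hu2) _ht1) _hr2, mul_nonneg (mul_nonneg (mul_nonneg (mul_nonneg _hy _hu2) _hc1) _hc1) _hr2,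
    mul_nonneg (mul_nonneg (mul_nonneg (mul_nonneg (mul_nonneg _hy _hv2) _hv2) _hv2) _hv2) _hb2,
    mul_nonneg (mul_nonneg (mul_nonneg (mul_nonneg _hy _hv2) _hv2) _hv2) _hc1,
    mul_nonneg (mul_nonneg (mul_nonneg (mul_nonneg (mul_nonneg _hy _hv2) _hv2) _ha2) _hc1) _hc1,
    mul_nonneg (mul_nonneg (mul_nonneg (mul_nonneg _hy _hv2) _ha1) _hc1) _hc1,
    mul_nonneg (mul_nonneg (mul_nonneg (mul_nonneg (mul_nonneg _hy _hv2) _ha2) _ha2) _hc1) _hc1,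
    mul_nonneg (mul_nonneg (mul_nonneg (mul_nonneg _hy _hv2) _ha2) _hc1) _hc1,
    mul_nonneg (mul_nonneg (mul_nonneg (mul_nonneg _hy _hv2) _hb2) _hb2) _ht1,
    mul_nonneg (mul_nonneg (mul_nonneg (mul_nonneg _hy _hv2) _ht1) _hc1) _hc1,
    mul_nonneg (mul_nonneg (mul_nonneg (mul_nonneg _hy _ha1) _ha2) _hc1) _hc1,
    mul_nonneg (mul_nonneg (mul_nonneg (mul_nonneg _hy _ha1) _hb2) _hb2) _hc1, mul_nonneg (mul_nonneg _hy _ha1) _ht1,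
    mul_nonneg (mul_nonneg (mul_nonneg (mul_nonneg (mul_nonneg _hy _ha2) _ha2) _ha2) _hsub) _hc1,
    mul_nonneg (mul_nonneg (mul_nonneg (mul_nonneg _hy _ha2) _hb2) _hb2) _hr2, mul_nonneg (mul_nonneg (mul_nonneg _hy _ha2) _ht1) _ht1,
    mul_nonneg (mul_nonneg (mul_nonneg _hy _ha2) _ht1) _hsub, mul_nonneg (mul_nonneg (mul_nonneg _hy _ha2) _ht1) _hc1,
    mul_nonneg (mul_nonneg (mul_nonneg _hy _ha2) _hsub) _hr1, mul_nonneg (mul_nonneg (mul_nonneg (mul_nonneg _hy _hb2) _hc1) _hc1) _hr2,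
    mul_nonneg (mul_nonneg (mul_nonneg _hy _ht1) _ht2) _hsub, mul_nonneg (mul_nonneg _hy _ht1) _hr2,
    mul_nonneg (mul_nonneg (mul_nonneg _hy _ht2) _hc1) _hc1, mul_nonneg (mul_nonneg _hy _hr2) _hr2,
    mul_nonneg (mul_nonneg (mul_nonneg (mul_nonneg _hhy _hhy) _hv1) _ha2) _ht2,
    mul_nonneg (mul_nonneg (mul_nonneg (mul_nonneg _hhy _hhy) _hv2) _hv2) _ht1,
    mul_nonneg (mul_nonneg (mul_nonneg (mul_nonneg _hhy _hhy) _ha2) _ht2) _hc1,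
    mul_nonneg (mul_nonneg (mul_nonneg (mul_nonneg _hhy _hu1) _hv1) _ha1) _ha2, mul_nonneg (mul_nonneg (mul_nonneg _hhy _hu1) _ha1) _ha1,
    mul_nonneg (mul_nonneg (mul_nonneg _hhy _hu1) _ha1) _ha2, mul_nonneg (mul_nonneg (mul_nonneg (mul_nonneg _hhy _hu1) _ha1) _ha2) _hb2,
    mul_nonneg (mul_nonneg (mul_nonneg _hhy _hu1) _ha1) _ht2, mul_nonneg (mul_nonneg (mul_nonneg _hhy _hu1) _ha1) _hr2,
    mul_nonneg (mul_nonneg (mul_nonneg (mul_nonneg _hhy _hv1) _hu2) _ha1) _ha2, mul_nonneg (mul_nonneg (mul_nonneg _hhy _hv1) _ha1) _ha1,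
    mul_nonneg (mul_nonneg (mul_nonneg _hhy _hv1) _ha1) _ha2, mul_nonneg (mul_nonneg (mul_nonneg (mul_nonneg _hhy _ha1) _ha2) _hb2) _hc1,
    mul_nonneg (mul_nonneg _hhy _ha1) _ht2, mul_nonneg (mul_nonneg (mul_nonneg _hhy _ha1) _hc1) _hr2,
    mul_nonneg (mul_nonneg (mul_nonneg _hhy _ha2) _ht2) _hc1, mul_nonneg (mul_nonneg _hhy _ht2) _ht2,
    mul_nonneg (mul_nonneg (mul_nonneg (mul_nonneg _hu1 _hu1) _hu2) _hv2) _hr2,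
    mul_nonneg (mul_nonneg (mul_nonneg (mul_nonneg _hu1 _hu1) _hv2) _ha2) _ht2, mul_nonneg (mul_nonneg (mul_nonneg _hu1 _hu1) _ha1) _ha2,
    mul_nonneg (mul_nonneg (mul_nonneg (mul_nonneg _hu1 _hu1) _ha1) _ha2) _ha2, mul_nonneg (mul_nonneg (mul_nonneg _hu1 _hu1) _ha1) _ht2,
    mul_nonneg (mul_nonneg (mul_nonneg _hu1 _hu1) _ha1) _hr2, mul_nonneg (mul_nonneg (mul_nonneg (mul_nonneg _hu1 _hu1) _ha2) _hsub) _hr2,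
    mul_nonneg (mul_nonneg (mul_nonneg _hu1 _hu1) _ht2) _ht2, mul_nonneg (mul_nonneg (mul_nonneg (mul_nonneg _hu1 _hv1) _ha2) _ha2) _hr2,
    mul_nonneg (mul_nonneg (mul_nonneg (mul_nonneg _hu1 _hv1) _ha2) _hc1) _hr2,
    mul_nonneg (mul_nonneg (mul_nonneg (mul_nonneg _hu1 _hu2) _hv2) _ha2) _hr2,
    mul_nonneg (mul_nonneg (mul_nonneg (mul_nonneg _hu1 _hv2) _hv2) _hv2) _hr2,
    mul_nonneg (mul_nonneg (mul_nonneg (mul_nonneg _hu1 _hv2) _hv2) _ha2) _hc1,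
    mul_nonneg (mul_nonneg (mul_nonneg (mul_nonneg _hu1 _hv2) _hv2) _ht1) _hsub, mul_nonneg (mul_nonneg (mul_nonneg _hu1 _hv2) _ht1) _hr2,
    mul_nonneg (mul_nonneg _hu1 _ha1) _ha1, mul_nonneg (mul_nonneg (mul_nonneg (mul_nonneg _hu1 _ha1) _ha2) _ha2) _ha2,
    mul_nonneg (mul_nonneg (mul_nonneg (mul_nonneg _hu1 _ha1) _ha2) _ha2) _hc1, mul_nonneg (mul_nonneg (mul_nonneg _hu1 _ha1) _ha2) _ht2,
    mul_nonneg (mul_nonneg (mul_nonneg _hu1 _ha1) _ht2) _hc1,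
    mul_nonneg (mul_nonneg (mul_nonneg (mul_nonneg (mul_nonneg _hu1 _ha2) _ha2) _ha2) _hsub) _hc1,
    mul_nonneg (mul_nonneg (mul_nonneg (mul_nonneg _hu1 _ha2) _ha2) _ht2) _hc1, mul_nonneg (mul_nonneg (mul_nonneg _hu1 _ha2) _ht2) _hr2,
    mul_nonneg (mul_nonneg (mul_nonneg _hu1 _ht2) _ht2) _hc1, mul_nonneg (mul_nonneg (mul_nonneg _hv1 _hu2) _ha1) _ha2,
    mul_nonneg (mul_nonneg (mul_nonneg _hv1 _hu2) _ha2) _ht2, mul_nonneg (mul_nonneg (mul_nonneg (mul_nonneg _hv1 _hu2) _ha2) _hsub) _hr2,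
    mul_nonneg (mul_nonneg (mul_nonneg _hv1 _hu2) _hr2) _hr2, mul_nonneg (mul_nonneg (mul_nonneg (mul_nonneg _hv1 _hv2) _hb2) _ht2) _hsub,
    mul_nonneg (mul_nonneg _hv1 _ha1) _ht2, mul_nonneg (mul_nonneg (mul_nonneg _hv1 _ha1) _hsub) _hr2,
    mul_nonneg (mul_nonneg (mul_nonneg _hv1 _ha1) _hc1) _hr2, mul_nonneg (mul_nonneg (mul_nonneg _hv1 _ha2) _ha2) _ha2,
    mul_nonneg (mul_nonneg (mul_nonneg (mul_nonneg _hv1 _ha2) _ha2) _ha2) _ha2,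
    mul_nonneg (mul_nonneg (mul_nonneg (mul_nonneg (mul_nonneg _hv1 _ha2) _ha2) _ha2) _hsub) _hc1,
    mul_nonneg (mul_nonneg (mul_nonneg (mul_nonneg _hv1 _ha2) _ha2) _hb2) _ht2,
    mul_nonneg (mul_nonneg (mul_nonneg (mul_nonneg _hv1 _ha2) _ha2) _ht2) _hc1,
    mul_nonneg (mul_nonneg (mul_nonneg (mul_nonneg _hv1 _ha2) _ha2) _hc1) _hr2,
    mul_nonneg (mul_nonneg (mul_nonneg (mul_nonneg _hv1 _ha2) _hb2) _hb2) _hr2, mul_nonneg (mul_nonneg (mul_nonneg _hv1 _ha2) _ht1) _ht2,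
    mul_nonneg (mul_nonneg _hv1 _ha2) _ht2, mul_nonneg (mul_nonneg (mul_nonneg (mul_nonneg _hv1 _ha2) _hsub) _hc1) _hr2,
    mul_nonneg (mul_nonneg (mul_nonneg _hv1 _hb2) _hr2) _hr2, mul_nonneg (mul_nonneg (mul_nonneg _hv1 _ht2) _hsub) _hr2,
    mul_nonneg (mul_nonneg (mul_nonneg _hv1 _hsub) _hr2) _hr2, mul_nonneg (mul_nonneg (mul_nonneg (mul_nonneg _hu2 _hu2) _hv2) _ht2) _hc1,
    mul_nonneg (mul_nonneg (mul_nonneg _hu2 _hu2) _ha1) _ha2, mul_nonneg (mul_nonneg (mul_nonneg (mul_nonneg _hu2 _hu2) _ha1) _ha2) _hb2,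
    mul_nonneg (mul_nonneg (mul_nonneg _hu2 _hv2) _hv2) _ha2, mul_nonneg (mul_nonneg (mul_nonneg _hu2 _hv2) _hv2) _ht1,
    mul_nonneg (mul_nonneg (mul_nonneg _hu2 _hv2) _ha1) _ht2, mul_nonneg (mul_nonneg (mul_nonneg (mul_nonneg _hu2 _hv2) _hc1) _hc1) _hr2,
    mul_nonneg (mul_nonneg (mul_nonneg _hu2 _ha1) _ha1) _hc1, mul_nonneg (mul_nonneg _hu2 _ha1) _ha2,
    mul_nonneg (mul_nonneg (mul_nonneg (mul_nonneg _hu2 _ha2) _ha2) _ha2) _ha2, mul_nonneg (mul_nonneg (mul_nonneg _hu2 _ht2) _hc1) _hr2,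
    mul_nonneg (mul_nonneg (mul_nonneg _hu2 _hc1) _hr2) _hr2, mul_nonneg (mul_nonneg (mul_nonneg _hv2 _hv2) _hv2) _hv2,
    mul_nonneg (mul_nonneg (mul_nonneg (mul_nonneg _hv2 _hv2) _hv2) _hv2) _hr2,
    mul_nonneg (mul_nonneg (mul_nonneg (mul_nonneg _hv2 _hv2) _hv2) _ha1) _hsub,
    mul_nonneg (mul_nonneg (mul_nonneg (mul_nonneg _hv2 _hv2) _hv2) _ha2) _hc1, mul_nonneg (mul_nonneg (mul_nonneg _hv2 _hv2) _hv2) _hr2,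
    mul_nonneg (mul_nonneg (mul_nonneg (mul_nonneg _hv2 _hv2) _ha2) _ht1) _hsub, mul_nonneg (mul_nonneg (mul_nonneg _hv2 _hv2) _hb2) _ht1,
    mul_nonneg (mul_nonneg (mul_nonneg _hv2 _hv2) _ht2) _ht2, mul_nonneg (mul_nonneg (mul_nonneg _hv2 _hv2) _ht2) _hsub,
    mul_nonneg (mul_nonneg (mul_nonneg (mul_nonneg _hv2 _hv2) _ht2) _hc1) _hc1, mul_nonneg (mul_nonneg (mul_nonneg _hv2 _hv2) _hr2) _hr2,
    mul_nonneg (mul_nonneg (mul_nonneg _hv2 _ha1) _ha1) _hsub, mul_nonneg (mul_nonneg (mul_nonneg _hv2 _ha1) _hb2) _ht2,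
    mul_nonneg (mul_nonneg _hv2 _ha1) _ht2, mul_nonneg (mul_nonneg (mul_nonneg _hv2 _hb1) _ht2) _hc1,
    mul_nonneg (mul_nonneg (mul_nonneg (mul_nonneg _hv2 _ha2) _ha2) _ha2) _hc1, mul_nonneg (mul_nonneg (mul_nonneg _hv2 _ha2) _hb2) _hr1,
    mul_nonneg (mul_nonneg (mul_nonneg _hv2 _ha2) _ht1) _ht1, mul_nonneg (mul_nonneg (mul_nonneg _hv2 _ha2) _ht1) _hsub,
    mul_nonneg (mul_nonneg (mul_nonneg _hv2 _ha2) _hr2) _hr2, mul_nonneg (mul_nonneg (mul_nonneg (mul_nonneg _hv2 _hb2) _ht2) _hc1) _hc1,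
    mul_nonneg (mul_nonneg _hv2 _ht1) _hr2, mul_nonneg (mul_nonneg (mul_nonneg _hv2 _ht2) _hc1) _hc1,
    mul_nonneg (mul_nonneg (mul_nonneg _ha1 _ha1) _ha2) _hb2, mul_nonneg (mul_nonneg _ha1 _ha1) _hc1, mul_nonneg (mul_nonneg _ha1 _hb1) _hr2,
    mul_nonneg (mul_nonneg (mul_nonneg (mul_nonneg _ha1 _ha2) _ha2) _ha2) _ha2, mul_nonneg (mul_nonneg (mul_nonneg _ha1 _ha2) _hb2) _hb2,
    mul_nonneg (mul_nonneg (mul_nonneg _ha1 _ha2) _ht2) _hc1, mul_nonneg (mul_nonneg _ha1 _ha2) _hc1, mul_nonneg _ha1 _ht2,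
    mul_nonneg (mul_nonneg (mul_nonneg _ha1 _hc1) _hc1) _hr2, mul_nonneg (mul_nonneg _hb1 _hr2) _hr2,
    mul_nonneg (mul_nonneg (mul_nonneg (mul_nonneg _ha2 _ha2) _ha2) _ha2) _ha2,
    mul_nonneg (mul_nonneg (mul_nonneg (mul_nonneg _ha2 _ha2) _ha2) _ht1) _hsub, mul_nonneg (mul_nonneg (mul_nonneg _ha2 _ha2) _ha2) _hr1,
    mul_nonneg (mul_nonneg (mul_nonneg _ha2 _ha2) _hb2) _ht2, mul_nonneg (mul_nonneg (mul_nonneg _ha2 _ha2) _ht2) _hr2,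
    mul_nonneg (mul_nonneg (mul_nonneg _ha2 _hb2) _hr2) _hr2, mul_nonneg (mul_nonneg (mul_nonneg _ha2 _ht2) _ht2) _hc1,
    mul_nonneg (mul_nonneg (mul_nonneg (mul_nonneg _ha2 _hsub) _hc1) _hc1) _hr2, mul_nonneg (mul_nonneg _ha2 _hr2) _hr2,
    mul_nonneg (mul_nonneg (mul_nonneg _hsub _hc1) _hr2) _hr2]

end IndepBlob

end Quant

end Summit.CriticalPhenomena.PercolationContinuityZ3.Theorems
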